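import Mathlib
import Summits.Ventures.PercRepro2.LocRows
import Summits.Ventures.PercRepro2.SwRow
import Summits.Ventures.PercRepro2.SwOut
import Summits.Ventures.PercRepro2.SwAllRow
import Summits.Ventures.PercRepro2.SwOutAll
import Summits.Ventures.PercRepro2.SwOutArmFlip
import Summits.Ventures.PercRepro2.SwOutArmThm
import Summits.Ventures.PercRepro2.SwOutCoreDefs
import Summits.Ventures.PercRepro2.SwOutShadowDefs
import Summits.Ventures.PercRepro2.SwOutShadowCube
import Summits.Ventures.PercRepro2.SwOutCoreShadowDefs
import Summits.Ventures.PercRepro2.SwOutEdgeDefs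
import Summits.Ventures.PercRepro2.SwOutEdgeShadow
import Summits.Ventures.PercRepro2.SwOutEdgeShadowFlip
import Summits.Ventures.PercRepro2.SwOutEdgeShadowArm

/-!
# Shadow points of an e-core cube are escaping (blind cell PercRepro2, night-4 g16, 2026-08-26;
proofs/NIGHT4-G15.md §4 (L4), proofs/NIGHT4-G16.md §4)

`SwOutCoreShadowEsc` for an e-core base (the junction `u` adjacent to `h`): `u` lies in the hull
of `h` at every shadow point, the edge from `u` into a dropped arm and an outside edge of a dropped
vertex have the colour opposite to `u`'s side, and when every dropped vertex adjacent to `u`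
carries an outside edge the hull of `u` leaves `U` at every shadow point.  Verbatim G13 on the
shadow base `CoreBaseE.shadowBase'` (the one-sided hypothesis is «no blue h-arm adjacent to `u`»).
-/

namespace Summit.Ventures.PercRepro2

namespace LocRows

open Hull

variable {V : Type*} {E : Type*}

open scoped Classical

variable {ends : E → Sym2 V}

section Esc

variable {ι : Type*} {A : ι → Set V} {pure : ι → Prop} {ζ : Config E} {h u : V} {H : Set V}
  (hb : CoreBaseE ends ζ h u H A pure) {ω₀ : Config ι}
  (huB : ¬ uRed ends A u pure (flipAll ω₀))
include hb huB

/-- The shadow base of a one-sided point, on the arm coordinates. -/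
theorem CoreBaseE.shadowBase' :
    ShadowBase ends (shadowOf ends u A ω₀ ζ) h (sZ ends u A ω₀) (sB ends u A ω₀) none := by
  have hs := hb.shadowBase (CoreBaseE.not_uRedE_flipAll_withHuRed (A := A) (pure := pure) huB)
  rwa [withHuRed_comp_some] at hs

/-- `u` lies in the hull of `h` at every shadow point. -/
theorem CoreBaseE.u_mem_hull_shadowReal (ω' : Config (Option {i : ι // ¬ uAdjC ends u A i})) :
    u ∈ hull ends (shadowReal ends (sB ends u A ω₀) (sZ ends u A ω₀) none
      (shadowOf ends u A ω₀ ζ) ω') h := by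
  have hs := hb.shadowBase' huB
  have huX : u ∈ sB ends u A ω₀ none := by simp only [sB]; exact mem_sX_iff.2 (Or.inl rfl)
  cases hω : ω' none with
  | true =>
    left
    rw [hs.cluster_shadowReal, mem_sRed_iff]
    exact Or.inr ⟨none, hω, huX⟩
  | false =>
    right
    rw [hs.cluster_blue_shadowReal, mem_sRed_iff]
    exact Or.inr ⟨none, by simp [flipAll, hω], huX⟩

/-- The edge from `u` into a dropped arm has the colour opposite to `u`'s side: blue at the
X-red points, red at the X-blue points. -/
lemma CoreBaseE.shadowReal_uZ (ω' : Config (Option {i : ι // ¬ uAdjC ends u A i})) {e : E} {z : V}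
    (hz : z ∈ sZ ends u A ω₀) (he : ends e = s(u, z)) :
    shadowReal ends (sB ends u A ω₀) (sZ ends u A ω₀) none (shadowOf ends u A ω₀ ζ) ω' e =
      !ω' none := by
  have hs := hb.shadowBase' huB
  have huX : u ∈ sB ends u A ω₀ none := by simp only [sB]; exact mem_sX_iff.2 (Or.inl rfl)
  rw [hs.shadowReal_apply_of_mem he huX, shadowOf_apply_of_mem_sZ hz he, hb.u_red e z he]
  cases ω' none <;> rfl

/-- An outside edge of a dropped vertex has the colour opposite to `u`'s side. -/
lemma CoreBaseE.shadowReal_Z_out (ω' : Config (Option {i : ι // ¬ uAdjC ends u A i})) {e : E}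
    {z y : V} (hz : z ∈ sZ ends u A ω₀) (he : ends e = s(z, y)) (hy : y ∉ H) :
    shadowReal ends (sB ends u A ω₀) (sZ ends u A ω₀) none (shadowOf ends u A ω₀ ζ) ω' e =
      !ω' none := by
  have hs := hb.shadowBase' huB
  have hyB : ∀ j, y ∉ sB ends u A ω₀ j := by
    intro j hyj
    apply hy
    rw [← hb.shadow_region_eq (ω₀ := ω₀)]
    exact Or.inl (Or.inr ⟨j, hyj⟩)
  rw [hs.shadowReal_apply_of_mem_Z he hz hyB]
  have hzR : z ∈ {h} ∪ {x | ∃ j, x ∈ sB ends u A ω₀ j} ∪ sZ ends u A ω₀ := Or.inr hz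
  have hyR : y ∉ {h} ∪ {x | ∃ j, x ∈ sB ends u A ω₀ j} ∪ sZ ends u A ω₀ := by
    rw [hb.shadow_region_eq]; exact hy
  rw [hs.bdry_blue e z y he hzR hyR]
  cases ω' none <;> rfl

/-- **Shadow points are escaping**: when every dropped vertex adjacent to `u` carries an edge
to the outside of `U` (`H ⊆ U`), the hull of `u` leaves `U` at every shadow point. -/
theorem CoreBaseE.hull_u_shadowReal_not_subset {U : Set V} (hHU : H ⊆ U)
    (hZout : ∀ z ∈ sZ ends u A ω₀, (∃ e, ends e = s(u, z)) → ∃ e y, ends e = s(z, y) ∧ y ∉ U)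
    (hZne : ∃ z ∈ sZ ends u A ω₀, ∃ e, ends e = s(u, z))
    (ω' : Config (Option {i : ι // ¬ uAdjC ends u A i})) :
    ¬ hull ends (shadowReal ends (sB ends u A ω₀) (sZ ends u A ω₀) none
      (shadowOf ends u A ω₀ ζ) ω') u ⊆ U := by
  intro hsub
  obtain ⟨z, hz, e, he⟩ := hZne
  obtain ⟨e', y, he', hyU⟩ := hZout z hz ⟨e, he⟩
  have hyH : y ∉ H := fun hyH => hyU (hHU hyH)
  have h1 := hb.shadowReal_uZ huB ω' hz he
  have h2 := hb.shadowReal_Z_out huB ω' hz he' hyH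
  set ζ' := shadowReal ends (sB ends u A ω₀) (sZ ends u A ω₀) none (shadowOf ends u A ω₀ ζ) ω'
  cases hω : ω' none with
  | true =>
    -- `u` red; the edges `u z` and `z y` are blue: `y ∈ C_B(u)`
    rw [hω] at h1 h2
    have hb1 : blue ζ' e = true := by rw [blue_apply, h1]; rfl
    have hb2 : blue ζ' e' = true := by rw [blue_apply, h2]; rfl
    have hz' : z ∈ cluster ends (blue ζ') u := mem_cluster_of_edge (mem_cluster_self _ _ _) hb1 he
    have hy' : y ∈ cluster ends (blue ζ') u := mem_cluster_of_edge hz' hb2 he'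
    exact hyU (hsub (Or.inr hy'))
  | false =>
    rw [hω] at h1 h2
    have hr1 : ζ' e = true := by rw [h1]; rfl
    have hr2 : ζ' e' = true := by rw [h2]; rfl
    have hz' : z ∈ cluster ends ζ' u := mem_cluster_of_edge (mem_cluster_self _ _ _) hr1 he
    have hy' : y ∈ cluster ends ζ' u := mem_cluster_of_edge hz' hr2 he'
    exact hyU (hsub (Or.inl hy'))

end Esc

end LocRows

end Summit.Ventures.PercRepro2
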